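import Mathlib
import Summits.AtomisticToContinuum.Crystallization.Theorems.ChargedEnergyGap.Negative.PeriodicForm
import Summits.AtomisticToContinuum.Crystallization.Theorems.ChargedEnergyGap.Negative.Unconditional
import Literature.MathematicalPhysics.StatisticalMechanics.BarlowStacking
import Literature.MathematicalPhysics.StatisticalMechanics.HaggStacking

/-!
# Route PricedLinkCensus — line Sketch (priced hcp windows) for `StackingHinge`
(stmt-AtomisticToContinuum-14993): the PERIODIC ⇒ FINITE transfer of the priced inequality
(stub `stub_pricedOfPeriodic`)

Fix an hcp scale `(a, h)`.  The PRICED INEQUALITY of the line in PERIODIC form says: for all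
`(δ₀, R, ε)` there are `κ > 0`, `L > 0`, `C` such that every `δ₀`-separated periodic configuration
`Q` of `ℝ³` satisfies `κ·#U_Q − C·#B_Q ≤ #motif · (e(Q) − e*)`, where `e* = ⨅_Q e_LJ(Q)`,
`B_Q` is the set of motif points whose `L·nn`-window (read in the infinite point set `Q.points`)
contains a point that is not charge-free at tolerance `1/100`, and `U_Q` is the set of motif points
outside `B_Q` whose `R`-window is NOT two-way `ε`-matched with a rigid image of
`barlowStacking a h alternatingHagg`.  We show that it implies the FINITE form
`N·e* + κ·#U − C'·#B ≤ E_LJ(y)` for injective `δ₀`-separated `y : Fin N → ℝ³` (same `κ`, `L`,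
and `C' = max C 0`).

Proof (far periodisation, the pattern of `ChargedEnergyGapNegative.noBoundary_of_periodicPricing`).
For `N ≤ 1` no site is charge-free, so `U = ∅`, and `N·e* ≤ E_LJ(y)` (`card_mul_eStar_le`).
For `N ≥ 2` periodise `y` with the tree's `ChargedEnergyGapNegative.periodise y c` and the cubic
period `c = (L + R + ε + δ₀ + 4)·(2D + 2)`, `D = Σ‖yᵢ‖`: the motif is `{yᵢ}`, `e(Q) ≤ E_LJ(y)/N`
(`energyPerParticle_periodise_le`), and every point of `Q.points` other than the `yⱼ` is at
distance `≥ c − 2D` from every `yᵢ` (`sub_le_dist_of_mem_points`), which exceeds `δ₀`, `R + ε`,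
`2L·D ≥ L·nn_i` and `4D`.  Hence `Q` is `δ₀`-separated, and at a motif point `yᵢ` the
nearest-neighbour distance, the bonds, the ring numbers, charge-freeness, the `L·nn`-window and the
two matching clauses read in `Q.points` are those read in `y`; so `#U(y) ≤ #U(Q)`,
`#B(Q) ≤ #B(y)`, `#motif = N`, and
`N·e* + κ·#U(y) − C'·#B(y) ≤ N·e* + κ·#U(Q) − C·#B(Q) ≤ N·e(Q) ≤ E_LJ(y)`.

All `[folklore]`; bookkeeping over the tree's periodisation API and `BondGraph.lean`.
-/

namespace Summit.AtomisticToContinuum.Crystallization.Theorems.PricedHcpWindowsPeriodicTransfer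

open Literature.MathematicalPhysics.StatisticalMechanics
open Literature.Geometry.DiscreteGeometry
open Summit.AtomisticToContinuum.Crystallization.Theorems.ChargedEnergyGapNegative

variable {N : ℕ}

/-! ### Motif points of a periodisation `periodise y c hc hN` (any period `c ≥ 2D + 2`) -/

/-- The sites `y i` are motif points of the periodisation. [folklore] -/
theorem mem_motif_periodise (y : Fin N → E3) (c : ℝˣ) (hc : period y ≤ (c : ℝ)) (hN : 0 < N)
    (i : Fin N) : y i ∈ (periodise y c hc hN).motif := by
  rw [motif_periodise]
  exact Finset.mem_image_of_mem y (Finset.mem_univ i)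

/-- The sites `y i` are points of the periodisation. [folklore] -/
theorem mem_points_periodise (y : Fin N → E3) (c : ℝˣ) (hc : period y ≤ (c : ℝ)) (hN : 0 < N)
    (i : Fin N) : y i ∈ (periodise y c hc hN).points :=
  (periodise y c hc hN).mem_points_of_mem_motif (mem_motif_periodise y c hc hN i)

/-- The map `j ↦ y j` into the points of the periodisation is injective for injective `y`.
[folklore] -/
theorem mk_points_injective {y : Fin N → E3} (hy : Function.Injective y) (c : ℝˣ)
    (hc : period y ≤ (c : ℝ)) (hN : 0 < N) :
    Function.Injective
      (fun j : Fin N => (⟨y j, mem_points_periodise y c hc hN j⟩ : (periodise y c hc hN).points)) :=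
  fun _ _ h => hy (congrArg Subtype.val h)

/-- Dichotomy: a point of the periodisation is a site `y j`, or it is far (distance `≥ c − 2D`)
from every site. [folklore] -/
theorem eq_or_far (y : Fin N → E3) (c : ℝˣ) (hc : period y ≤ (c : ℝ)) (hN : 0 < N)
    (p : (periodise y c hc hN).points) :
    (∃ j, (p : E3) = y j) ∨ ∀ i, (c : ℝ) - 2 * Dsum y ≤ dist (y i) p := by
  by_cases h : ∃ j, (p : E3) = y j
  · exact Or.inl h
  · push Not at h
    exact Or.inr fun i => sub_le_dist_of_mem_points y c hc hN i p.2 h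

/-- **Separation.**  If the sites are pairwise `δ`-separated and `δ ≤ c − 2D`, then the points
of the periodisation are pairwise `δ`-separated. [folklore] -/
theorem le_dist_periodise {y : Fin N → E3} (c : ℝˣ) (hc : period y ≤ (c : ℝ)) (hN : 0 < N)
    {δ : ℝ} (hδ : δ ≤ (c : ℝ) - 2 * Dsum y) (hsep : ∀ i j : Fin N, i ≠ j → δ ≤ dist (y i) (y j))
    (p q : (periodise y c hc hN).points) (hpq : p ≠ q) : δ ≤ dist (p : E3) q := by
  obtain ⟨v, hv, g, hg, hpv⟩ := p.2
  rw [motif_periodise, Finset.mem_image] at hv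
  obtain ⟨i, -, rfl⟩ := hv
  have hq' : (q : E3) - g ∈ (periodise y c hc hN).points := by
    have := (periodise y c hc hN).add_mem_points q.2 ((periodise y c hc hN).lattice.neg_mem hg)
    simpa [sub_eq_add_neg] using this
  have hdist : dist (p : E3) q = dist (y i) ((q : E3) - g) := by
    rw [hpv, ← dist_add_right (y i) ((q : E3) - g) g, sub_add_cancel]
  rw [hdist]
  by_cases h : ∃ k, (q : E3) - g = y k
  · obtain ⟨k, hk⟩ := h
    rw [hk]
    refine hsep i k fun hik => hpq (Subtype.ext ?_)
    rw [hpv, hik, ← hk, sub_add_cancel]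
  · push Not at h
    exact hδ.trans (sub_le_dist_of_mem_points y c hc hN i hq' h)

/-! ### Windows, bonds and charges of motif points are those of `y` -/

/-- Nearest-neighbour distances of the sites, read in the periodic point set, are those of `y`
(`y` injective, `N ≥ 2`, far distance `≥ 2D`). [folklore] -/
theorem nearestDist_periodise {y : Fin N → E3} (hy : Function.Injective y) (c : ℝˣ)
    (hc : period y ≤ (c : ℝ)) (hN : 0 < N) (hfar : 2 * Dsum y ≤ (c : ℝ) - 2 * Dsum y)
    {i : Fin N} (hi : ∃ j, j ≠ i) (p : (periodise y c hc hN).points) (hp : (p : E3) = y i) :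
    nearestDist (Subtype.val : (periodise y c hc hN).points → E3) p = nearestDist y i := by
  obtain ⟨j₀, hj₀, hnn⟩ := exists_nearestDist_eq_dist y hi
  obtain ⟨p₀, hp₀⟩ : ∃ p₀ : (periodise y c hc hN).points, (p₀ : E3) = y j₀ :=
    ⟨⟨y j₀, mem_points_periodise y c hc hN j₀⟩, rfl⟩
  have hne0 : p₀ ≠ p := fun h => hj₀ (hy (by rw [← hp₀, ← hp, h]))
  apply le_antisymm
  · calc nearestDist (Subtype.val : (periodise y c hc hN).points → E3) p
        ≤ dist (p : E3) p₀ := nearestDist_le_dist _ hne0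
      _ = nearestDist y i := by rw [hp, hp₀, hnn]
  · refine le_nearestDist ⟨p₀, hne0⟩ fun q hq => ?_
    rcases eq_or_far y c hc hN q with ⟨j, hj⟩ | hfar'
    · have hji : j ≠ i := fun h => hq (Subtype.ext (by rw [hj, hp, h]))
      rw [hp, hj]
      exact nearestDist_le_dist y hji
    · calc nearestDist y i ≤ 2 * Dsum y := nearestDist_le_two_Dsum y hj₀
        _ ≤ (c : ℝ) - 2 * Dsum y := hfar
        _ ≤ dist (y i) q := hfar' i
        _ = dist (p : E3) q := by rw [hp]

/-- Bonds at the sites, read in the periodic point set, are exactly the bonds of `y` (`η ≤ 1`,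
far distance `> 4D`). [folklore] -/
theorem adj_periodise_iff {y : Fin N → E3} (hy : Function.Injective y) (c : ℝˣ)
    (hc : period y ≤ (c : ℝ)) (hN : 0 < N) (hfar : 4 * Dsum y < (c : ℝ) - 2 * Dsum y)
    {η : ℝ} (hη1 : η ≤ 1) (hN2 : ∀ i : Fin N, ∃ j, j ≠ i) {i : Fin N}
    (p : (periodise y c hc hN).points) (hp : (p : E3) = y i) (q : (periodise y c hc hN).points) :
    (bondGraph η (Subtype.val : (periodise y c hc hN).points → E3)).Adj p q ↔
      ∃ j, (q : E3) = y j ∧ (bondGraph η y).Adj i j := by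
  have hfar2 : 2 * Dsum y ≤ (c : ℝ) - 2 * Dsum y := by linarith [Dsum_nonneg y]
  constructor
  · intro h
    obtain ⟨hne, hle⟩ := bondGraph_adj.1 h
    rw [nearestDist_periodise hy c hc hN hfar2 (hN2 i) p hp] at hle
    rcases eq_or_far y c hc hN q with ⟨j, hj⟩ | hfar'
    · refine ⟨j, hj, bondGraph_adj.2 ⟨fun h' => hne (Subtype.ext (by rw [hp, hj, h'])), ?_⟩⟩
      rw [nearestDist_periodise hy c hc hN hfar2 (hN2 j) q hj, hp, hj] at hle
      exact hle
    · exfalso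
      obtain ⟨j₀, hj₀⟩ := hN2 i
      have hnn : nearestDist y i ≤ 2 * Dsum y := nearestDist_le_two_Dsum y hj₀
      have hmin : min (nearestDist y i)
          (nearestDist (Subtype.val : (periodise y c hc hN).points → E3) q) ≤ 2 * Dsum y :=
        (min_le_left _ _).trans hnn
      have h1 : (1 + η) * min (nearestDist y i)
          (nearestDist (Subtype.val : (periodise y c hc hN).points → E3) q) ≤
            2 * (2 * Dsum y) :=
        mul_le_mul (by linarith) hmin (le_min (nearestDist_nonneg _ _) (nearestDist_nonneg _ _))
          (by norm_num)
      have h2 := hfar' i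
      rw [hp] at hle
      linarith
  · rintro ⟨j, hj, hadj⟩
    obtain ⟨hne, hle⟩ := bondGraph_adj.1 hadj
    refine bondGraph_adj.2 ⟨fun h => hne (hy (by rw [← hp, ← hj, h])), ?_⟩
    rw [nearestDist_periodise hy c hc hN hfar2 (hN2 i) p hp,
      nearestDist_periodise hy c hc hN hfar2 (hN2 j) q hj, hp, hj]
    exact hle

/-- Neighbour sets of the sites are the images of the neighbour sets of `y`. [folklore] -/
theorem neighborSet_periodise {y : Fin N → E3} (hy : Function.Injective y) (c : ℝˣ)
    (hc : period y ≤ (c : ℝ)) (hN : 0 < N) (hfar : 4 * Dsum y < (c : ℝ) - 2 * Dsum y)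
    {η : ℝ} (hη1 : η ≤ 1) (hN2 : ∀ i : Fin N, ∃ j, j ≠ i) {i : Fin N}
    (p : (periodise y c hc hN).points) (hp : (p : E3) = y i) :
    (bondGraph η (Subtype.val : (periodise y c hc hN).points → E3)).neighborSet p =
      (fun j : Fin N => (⟨y j, mem_points_periodise y c hc hN j⟩ : (periodise y c hc hN).points)) ''
        (bondGraph η y).neighborSet i := by
  ext q
  rw [SimpleGraph.mem_neighborSet, adj_periodise_iff hy c hc hN hfar hη1 hN2 p hp, Set.mem_image]
  constructor
  · rintro ⟨j, hj, hadj⟩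
    exact ⟨j, hadj, Subtype.ext hj.symm⟩
  · rintro ⟨j, hadj, rfl⟩
    exact ⟨j, rfl, hadj⟩

/-- Ring numbers along bonds of the sites are those of `y`. [folklore] -/
theorem ringNumber_periodise {y : Fin N → E3} (hy : Function.Injective y) (c : ℝˣ)
    (hc : period y ≤ (c : ℝ)) (hN : 0 < N) (hfar : 4 * Dsum y < (c : ℝ) - 2 * Dsum y)
    {η : ℝ} (hη1 : η ≤ 1) (hN2 : ∀ i : Fin N, ∃ j, j ≠ i) {i j : Fin N}
    (p q : (periodise y c hc hN).points) (hp : (p : E3) = y i) (hq : (q : E3) = y j) :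
    ringNumber η (Subtype.val : (periodise y c hc hN).points → E3) p q = ringNumber η y i j := by
  rw [ringNumber_def, ringNumber_def, neighborSet_periodise hy c hc hN hfar hη1 hN2 p hp,
    neighborSet_periodise hy c hc hN hfar hη1 hN2 q hq,
    ← Set.image_inter (mk_points_injective hy c hc hN),
    Set.ncard_image_of_injective _ (mk_points_injective hy c hc hN)]

/-- **Charge of the sites read in the periodic point set = charge in `y`.** [folklore] -/
theorem isChargeFree_periodise_iff {y : Fin N → E3} (hy : Function.Injective y) (c : ℝˣ)
    (hc : period y ≤ (c : ℝ)) (hN : 0 < N) (hfar : 4 * Dsum y < (c : ℝ) - 2 * Dsum y)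
    {η : ℝ} (hη1 : η ≤ 1) (hN2 : ∀ i : Fin N, ∃ j, j ≠ i) {i : Fin N}
    (p : (periodise y c hc hN).points) (hp : (p : E3) = y i) :
    IsChargeFree η (Subtype.val : (periodise y c hc hN).points → E3) p ↔ IsChargeFree η y i := by
  rw [isChargeFree_iff, isChargeFree_iff, neighborSet_periodise hy c hc hN hfar hη1 hN2 p hp,
    Set.ncard_image_of_injective _ (mk_points_injective hy c hc hN), Set.forall_mem_image]
  refine and_congr_right fun _ => forall₂_congr fun j _ => ?_
  rw [ringNumber_periodise hy c hc hN hfar hη1 hN2 p _ hp rfl]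

/-- **Window transfer.**  If the `L·nn_i`-window of `y i` in `y` is charge-free, then so is the
`L·nn`-window of the site `y i` read in the periodic point set (far distance `> 4D` and
`> 2L·D`). [folklore] -/
theorem goodWindow_periodise {y : Fin N → E3} (hy : Function.Injective y) (c : ℝˣ)
    (hc : period y ≤ (c : ℝ)) (hN : 0 < N) (hfar : 4 * Dsum y < (c : ℝ) - 2 * Dsum y)
    (hN2 : ∀ i : Fin N, ∃ j, j ≠ i) {L : ℝ} (hL : 0 ≤ L)
    (hfarL : L * (2 * Dsum y) < (c : ℝ) - 2 * Dsum y) {i : Fin N}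
    (p : (periodise y c hc hN).points) (hp : (p : E3) = y i)
    (hgood : ∀ j : Fin N, dist (y i) (y j) ≤ L * nearestDist y i → IsChargeFree (1 / 100 : ℝ) y j)
    (q : (periodise y c hc hN).points)
    (hq : dist (p : E3) q ≤ L * nearestDist (Subtype.val : (periodise y c hc hN).points → E3) p) :
    IsChargeFree (1 / 100 : ℝ) (Subtype.val : (periodise y c hc hN).points → E3) q := by
  have hfar2 : 2 * Dsum y ≤ (c : ℝ) - 2 * Dsum y := by linarith [Dsum_nonneg y]
  rw [nearestDist_periodise hy c hc hN hfar2 (hN2 i) p hp, hp] at hq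
  rcases eq_or_far y c hc hN q with ⟨j, hj⟩ | hfar'
  · rw [hj] at hq
    exact (isChargeFree_periodise_iff hy c hc hN hfar (by norm_num) hN2 q hj).2 (hgood j hq)
  · exfalso
    obtain ⟨j₀, hj₀⟩ := hN2 i
    have hnn : nearestDist y i ≤ 2 * Dsum y := nearestDist_le_two_Dsum y hj₀
    have h1 : L * nearestDist y i ≤ L * (2 * Dsum y) := mul_le_mul_of_nonneg_left hnn hL
    have h2 := hfar' i
    linarith

/-- **Matching transfer.**  A two-way `ε`-matching of the `R`-window of the site `y i`, read in
the periodic point set, with a rigid image of `S` is a two-way `ε`-matching of the `R`-window of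
`y i` in `y` (far distance `> R + ε`). [folklore] -/
theorem rigidMatch_of_periodise {y : Fin N → E3} (c : ℝˣ) (hc : period y ≤ (c : ℝ)) (hN : 0 < N)
    {S : Set E3} {R ε : ℝ} (hfarR : R + ε < (c : ℝ) - 2 * Dsum y) {i : Fin N}
    (p : (periodise y c hc hN).points) (hp : (p : E3) = y i)
    (hm : ∃ g : E3 ≃ᵃⁱ[ℝ] E3,
      (∀ q : (periodise y c hc hN).points, dist (p : E3) q ≤ R → ∃ z ∈ S, dist (q : E3) (g z) ≤ ε) ∧
      (∀ z ∈ S, dist (p : E3) (g z) ≤ R →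
        ∃ q : (periodise y c hc hN).points, dist (q : E3) (g z) ≤ ε)) :
    ∃ g : E3 ≃ᵃⁱ[ℝ] E3, (∀ j : Fin N, dist (y i) (y j) ≤ R → ∃ z ∈ S, dist (y j) (g z) ≤ ε) ∧
      (∀ z ∈ S, dist (y i) (g z) ≤ R → ∃ j : Fin N, dist (y j) (g z) ≤ ε) := by
  obtain ⟨g, h1, h2⟩ := hm
  refine ⟨g, fun j hj => ?_, fun z hz hzR => ?_⟩
  · exact h1 ⟨y j, mem_points_periodise y c hc hN j⟩ (by rw [hp]; exact hj)
  · obtain ⟨q, hq⟩ := h2 z hz (by rw [hp]; exact hzR)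
    rcases eq_or_far y c hc hN q with ⟨j, hj⟩ | hfar'
    · exact ⟨j, by rw [← hj]; exact hq⟩
    · exfalso
      have h3 : dist (y i) q ≤ R + ε :=
        calc dist (y i) q ≤ dist (y i) (g z) + dist (g z) q := dist_triangle _ _ _
          _ ≤ R + ε := by rw [dist_comm (g z)]; exact add_le_add hzR hq
      linarith [hfar' i]

/-! ### Counting and arithmetic -/

/-- An injection `f` mapping `P` into `Q` bounds `#{a // P a}` by `#{b // Q b}`. [folklore] -/
theorem card_subtype_le_of_mapsTo {α β : Type*} [Finite β] {P : α → Prop} {Q : β → Prop}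
    (f : α → β) (hf : Function.Injective f) (h : ∀ a, P a → Q (f a)) :
    Nat.card {a // P a} ≤ Nat.card {b // Q b} :=
  Nat.card_le_card_of_injective (fun a : {a // P a} => (⟨f a.1, h a.1 a.2⟩ : {b // Q b}))
    fun _ _ hab => Subtype.ext (hf (congrArg Subtype.val hab))

/-- An everywhere-false predicate cuts out a subtype of cardinality `0`. [folklore] -/
theorem card_subtype_eq_zero {α : Type*} {P : α → Prop} (h : ∀ a, ¬ P a) :
    Nat.card {a // P a} = 0 := by
  haveI : IsEmpty {a // P a} := ⟨fun a => h a.1 a.2⟩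
  exact Nat.card_of_isEmpty

/-- The final arithmetic: `κ·#U_Q − C·#B_Q ≤ m·(e(Q) − e*)`, `m = N`, `e(Q) ≤ E/N`,
`#U_y ≤ #U_Q`, `#B_Q ≤ #B_y` give `N·e* + κ·#U_y − max C 0 · #B_y ≤ E`. [folklore] -/
theorem assemble {N m uy uQ bQ bY : ℕ} {κ C e E eQ : ℝ} (hκ : 0 < κ)
    (HQ : κ * (uQ : ℝ) - C * (bQ : ℝ) ≤ (m : ℝ) * (eQ - e)) (hm : m = N) (hN : 0 < N)
    (he : eQ ≤ E / N) (hU : uy ≤ uQ) (hB : bQ ≤ bY) :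
    (N : ℝ) * e + κ * (uy : ℝ) - max C 0 * (bY : ℝ) ≤ E := by
  subst hm
  have hNr : (0 : ℝ) < m := by exact_mod_cast hN
  rw [le_div_iff₀ hNr] at he
  have hU' : (uy : ℝ) ≤ uQ := by exact_mod_cast hU
  have hB' : (bQ : ℝ) ≤ bY := by exact_mod_cast hB
  have h1 : κ * (uy : ℝ) ≤ κ * uQ := mul_le_mul_of_nonneg_left hU' hκ.le
  have h2 : C * (bQ : ℝ) ≤ max C 0 * bQ :=
    mul_le_mul_of_nonneg_right (le_max_left _ _) (Nat.cast_nonneg _)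
  have h3 : max C 0 * (bQ : ℝ) ≤ max C 0 * bY := mul_le_mul_of_nonneg_left hB' (le_max_right _ _)
  linarith

/-- The small case: `#U_y = 0` and `N·e* ≤ E` give the inequality. [folklore] -/
theorem assemble_small {N uy bY : ℕ} {κ C e E : ℝ} (hu : uy = 0) (he : (N : ℝ) * e ≤ E) :
    (N : ℝ) * e + κ * (uy : ℝ) - max C 0 * (bY : ℝ) ≤ E := by
  subst hu
  have h0 : 0 ≤ max C 0 * (bY : ℝ) := mul_nonneg (le_max_right _ _) (Nat.cast_nonneg _)
  push_cast
  linarith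

/-! ### The transfer -/

/-- **Periodic ⇒ finite transfer of the priced inequality** (stub `stub_pricedOfPeriodic` of line
Sketch for `StackingHinge`).  For every scale `(a, h)`: the priced inequality for all
`δ₀`-separated PERIODIC configurations (windows, bonds, charges and matchings of motif points read
in the infinite point set `Q.points`, counts over the motif, right side `#motif·(e(Q) − e*)`)
implies the finite priced inequality `N·e* + κ·#U − C·#B ≤ E_LJ(y)` for injective `δ₀`-separated
`y : Fin N → ℝ³`, by far periodisation with the cubic period `(L + R + ε + δ₀ + 4)·(2D + 2)`.
[folklore] -/
theorem stub_pricedOfPeriodic : ∀ (a h : ℝ), (∀ δ₀ : ℝ, 0 < δ₀ → ∀ R ε : ℝ, 0 < R → 0 < ε → ∃ κ L C : ℝ, 0 < κ ∧ 0 < L ∧ ∀ Q : Literature.MathematicalPhysics.StatisticalMechanics.PeriodicConfiguration 3, (∀ p q : Q.points, p ≠ q → δ₀ ≤ dist (p : EuclideanSpace ℝ (Fin 3)) (q : EuclideanSpace ℝ (Fin 3))) → κ * (Nat.card {x : Q.motif // (∀ j : Q.points, dist ((Subtype.val : Q.points → EuclideanSpace ℝ (Fin 3)) ⟨x.1, Q.mem_points_of_mem_motif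 x.2⟩) ((Subtype.val : Q.points → EuclideanSpace ℝ (Fin 3)) j) ≤ L * Literature.Geometry.DiscreteGeometry.nearestDist (Subtype.val : Q.points → EuclideanSpace ℝ (Fin 3)) ⟨x.1, Q.mem_points_of_mem_motif x.2⟩ → Literature.Geometry.DiscreteGeometry.IsChargeFree (1 / 100 : ℝ) (Subtype.val : Q.points → EuclideanSpace ℝ (Fin 3)) j) ∧ ¬ ∃ g : EuclideanSpace ℝ (Fin 3) ≃ᵃⁱ[ℝ] EuclideanSpace ℝ (Fin 3), (∀ j : Q.points, dist ((Subtype.val : Q.points → EuclideanSpace ℝ (Fin 3)) ⟨x.1, Q.mem_points_of_mem_motif x.2⟩) ((Subtype.val : Q.points → EuclideanSpace ℝ (Fin 3)) j) ≤ R → ∃ z ∈ Literature.MathematicalPhysics.StatisticalMechanics.barlowStacking a h Literature.MathematicalPhysics.StatisticalMechanics.alternatingHagg, dist ((Subtype.val : Q.points → EuclideanSpace ℝ (Fin 3)) j) (g z) ≤ ε) ∧ (∀ z ∈ Literature.MathematicalPhysics.StatisticalMechanics.barlowStacking a h Literature.MathematicalPhysics.StatisticalMechanics.alternatingHagg, dist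 ((Subtype.val : Q.points → EuclideanSpace ℝ (Fin 3)) ⟨x.1, Q.mem_points_of_mem_motif x.2⟩) (g z) ≤ R → ∃ j : Q.points, dist ((Subtype.val : Q.points → EuclideanSpace ℝ (Fin 3)) j) (g z) ≤ ε)} : ℝ) - C * (Nat.card {x : Q.motif // ¬ ∀ j : Q.points, dist ((Subtype.val : Q.points → EuclideanSpace ℝ (Fin 3)) ⟨x.1, Q.mem_points_of_mem_motif x.2⟩) ((Subtype.val : Q.points → EuclideanSpace ℝ (Fin 3)) j) ≤ L * Literature.Geometry.DiscreteGeometry.nearestDist (Subtype.val : Q.points → EuclideanSpace ℝ (Fin 3)) ⟨x.1, Q.mem_points_of_mem_motif x.2⟩ → Literature.Geometry.DiscreteGeometry.IsChargeFree (1 / 100 : ℝ) (Subtype.val : Q.points → EuclideanSpace ℝ (Fin 3)) j} : ℝ) ≤ (Q.motif.card : ℝ) * (Q.energyPerParticle Literature.MathematicalPhysics.StatisticalMechanics.lennardJones - (⨅ Q : Literature.MathematicalPhysics.StatisticalMechanics.PeriodicConfiguration 3, Q.energyPerParticle Literature.MathematicalPhysics.StatisticalMechanics.lennardJones))) → ∀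 δ₀ : ℝ, 0 < δ₀ → ∀ R ε : ℝ, 0 < R → 0 < ε → ∃ κ L C : ℝ, 0 < κ ∧ 0 < L ∧ ∀ (N : ℕ) (y : Fin N → EuclideanSpace ℝ (Fin 3)), Function.Injective y → (∀ i j : Fin N, i ≠ j → δ₀ ≤ dist (y i) (y j)) → (N : ℝ) * (⨅ Q : Literature.MathematicalPhysics.StatisticalMechanics.PeriodicConfiguration 3, Q.energyPerParticle Literature.MathematicalPhysics.StatisticalMechanics.lennardJones) + κ * (Nat.card {i : Fin N // (∀ j : Fin N, dist (y i) (y j) ≤ L * Literature.Geometry.DiscreteGeometry.nearestDist y i → Literature.Geometry.DiscreteGeometry.IsChargeFree (1 / 100 : ℝ) y j) ∧ ¬ ∃ g : EuclideanSpace ℝ (Fin 3) ≃ᵃⁱ[ℝ] EuclideanSpace ℝ (Fin 3), (∀ j : Fin N, dist (y i) (y j) ≤ R → ∃ z ∈ Literature.MathematicalPhysics.StatisticalMechanics.barlowStacking a h Literature.MathematicalPhysics.StatisticalMechanics.alternatingHagg, dist (y j) (g z) ≤ ε) ∧ (∀ z ∈ Literature.MathematicalPhysics.StatisticalMechanics.barlowStacking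 a h Literature.MathematicalPhysics.StatisticalMechanics.alternatingHagg, dist (y i) (g z) ≤ R → ∃ j : Fin N, dist (y j) (g z) ≤ ε)} : ℝ) - C * (Nat.card {i : Fin N // ¬ ∀ j : Fin N, dist (y i) (y j) ≤ L * Literature.Geometry.DiscreteGeometry.nearestDist y i → Literature.Geometry.DiscreteGeometry.IsChargeFree (1 / 100 : ℝ) y j} : ℝ) ≤ Literature.MathematicalPhysics.StatisticalMechanics.interactionEnergy Literature.MathematicalPhysics.StatisticalMechanics.lennardJones y := by
  intro a h hPer δ₀ hδ₀ R ε hR hε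
  obtain ⟨κ, L, C, hκ, hL, H⟩ := hPer δ₀ hδ₀ R ε hR hε
  refine ⟨κ, L, max C 0, hκ, hL, fun N y hy hsep => ?_⟩
  rcases Nat.lt_or_ge N 2 with hN2 | hN2
  · -- `N ≤ 1`: no site is charge-free, so no window is good and `U = ∅`; `N·e* ≤ E_LJ(y)`.
    have hnot : ∀ i : Fin N, ¬ IsChargeFree (1 / 100 : ℝ) y i := fun i =>
      not_isChargeFree_of_card_le (by rw [Nat.card_fin]; omega) _ y i
    refine assemble_small ?_ (card_mul_eStar_le hy)
    refine card_subtype_eq_zero fun i hi => hnot i (hi.1 i ?_)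
    rw [dist_self]
    exact mul_nonneg hL.le (nearestDist_nonneg _ _)
  · -- `N ≥ 2`: far periodisation.
    have hN0 : 0 < N := by omega
    have hN2' : ∀ i : Fin N, ∃ j, j ≠ i := exists_ne_of_two_le hN2
    have hD := Dsum_nonneg y
    have hper : 0 < period y := period_pos y
    have hT : 0 < L + R + ε + δ₀ + 4 := by linarith
    obtain ⟨c, hcv⟩ : ∃ c : ℝˣ, (c : ℝ) = (L + R + ε + δ₀ + 4) * period y :=
      ⟨Units.mk0 _ (mul_pos hT hper).ne', rfl⟩
    have hc : period y ≤ (c : ℝ) := by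
      rw [hcv]
      have := mul_nonneg (by linarith : (0 : ℝ) ≤ L + R + ε + δ₀ + 3) hper.le
      linarith
    have hfar_eq : (c : ℝ) - 2 * Dsum y = 2 * (L * Dsum y) + 2 * (R * Dsum y) + 2 * (ε * Dsum y)
        + 2 * (δ₀ * Dsum y) + 6 * Dsum y + 2 * L + 2 * R + 2 * ε + 2 * δ₀ + 8 := by
      rw [hcv]
      unfold period
      ring
    have hLD : 0 ≤ L * Dsum y := mul_nonneg hL.le hD
    have hRD : 0 ≤ R * Dsum y := mul_nonneg hR.le hD
    have hεD : 0 ≤ ε * Dsum y := mul_nonneg hε.le hD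
    have hδD : 0 ≤ δ₀ * Dsum y := mul_nonneg hδ₀.le hD
    have hfar4 : 4 * Dsum y < (c : ℝ) - 2 * Dsum y := by rw [hfar_eq]; linarith
    have hfarL : L * (2 * Dsum y) < (c : ℝ) - 2 * Dsum y := by rw [hfar_eq]; linarith
    have hfarR : R + ε < (c : ℝ) - 2 * Dsum y := by rw [hfar_eq]; linarith
    have hfarδ : δ₀ ≤ (c : ℝ) - 2 * Dsum y := by rw [hfar_eq]; linarith
    -- the periodic hypothesis at the periodisation
    specialize H (periodise y c hc hN0) (le_dist_periodise c hc hN0 hfarδ hsep)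
    have hcard : (periodise y c hc hN0).motif.card = N := by
      rw [motif_periodise, Finset.card_image_of_injective _ hy, Finset.card_univ, Fintype.card_fin]
    have he := energyPerParticle_periodise_le hy c hc hN0
    -- the index of a motif point
    have hidx : ∀ x : (periodise y c hc hN0).motif, ∃ i : Fin N, y i = (x : E3) := by
      rintro ⟨v, hv⟩
      have hv' := hv
      rw [motif_periodise, Finset.mem_image] at hv'
      obtain ⟨i, -, hi⟩ := hv'
      exact ⟨i, hi⟩
    choose idx hidx using hidx
    refine assemble hκ H hcard hN0 he ?_ ?_
    · -- `#U(y) ≤ #U(Q)` via `i ↦ y i`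
      refine card_subtype_le_of_mapsTo
        (fun i : Fin N => (⟨y i, mem_motif_periodise y c hc hN0 i⟩ : (periodise y c hc hN0).motif))
        (fun i j hij => hy (congrArg Subtype.val hij)) fun i hi => ⟨?_, ?_⟩
      · exact fun q hq => goodWindow_periodise hy c hc hN0 hfar4 hN2' hL.le hfarL _ rfl hi.1 q hq
      · exact fun hm => hi.2 (rigidMatch_of_periodise c hc hN0 hfarR _ rfl hm)
    · -- `#B(Q) ≤ #B(y)` via `x ↦ idx x`
      refine card_subtype_le_of_mapsTo idx
        (fun x x' hxx' => Subtype.ext (by rw [← hidx x, ← hidx x', hxx'])) fun x hx hgood => hx ?_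
      exact fun q hq =>
        goodWindow_periodise hy c hc hN0 hfar4 hN2' hL.le hfarL _ (hidx x).symm hgood q hq

end Summit.AtomisticToContinuum.Crystallization.Theorems.PricedHcpWindowsPeriodicTransfer
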